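import Summits.Ventures.Crystal3D.Bulk.HullRotSysFaces
import Literature.Geometry.DiscreteGeometry.SphericalCodeHullConnected
import Mathlib.Dynamics.PeriodicPts.Defs
import HarnessLib

/-!
# The hull rotation system, part 3: `σ_H` is ONE cycle at every vertex, and the dart set is
# connected (brick (G2) of `phase2/LEAN-FACES-DESIGN.md` §5.3, concluded)

HONEST FRAMING. Part of the venture `Summits/Ventures/Crystal3D` (cell `pub-crystal3d`, phase 2;
seat p3), generic and configuration-free (`X` any finite set of unit vectors of `ℝ³` with
`0 ∈ interior (conv X)`); nothing here mentions GAP(1.26). With `Bulk/HullRotSys.lean` (darts,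
`σ_H = hullSucc X`, `α = Prod.swap`) and `Bulk/HullRotSysFaces.lean` (`φ_H`, faces = fan
triangles, `#darts = 3·#triangles`, `#triangles + 4 = 2N`, tails = `X`) this file supplies the
two remaining counts of the Euler relation `V − E + F = 2` for the hull map:

* `exists_iterate_hullSucc_eq_self` — every dart returns (`σ_H` is a bijection of a finite
  set); `iterate_hullSucc_mem_hullDarts`, `injOn_iterate_hullSucc`;
* **`exists_iterate_hullSucc_eq`** — `σ_H` acts TRANSITIVELY on the darts with a given tail:
  the rotation at each vertex is a single cycle (the Literature's single-cycle vertex link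
  `fanTriSets_link`, transported to darts), so the vertex orbits of `σ_H` are in bijection with
  `X` (`V = N`, with `image_fst_hullDarts`);
* **`eq_hullDarts_of_closed`** — CONNECTEDNESS in closure form: a nonempty set of darts closed
  under `σ_H` and `α` is the whole dart set (one `⟨σ_H, α⟩`-class, `k = 1`; from the Literature's
  `eq_of_fanTriSets_closed`).

With `N` vertex cycles, `E = 3N − 6` edges (`#darts = 6N − 12`), `F = 2N − 4` triangular faces
and one class: `V − E + F = 2` — the ambient planar map for the deletion lemma (G1); the wiring
of the oriented tight map as the sub-system induced on the tight darts is (G3) (typer-bulk-2).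
-/

noncomputable section

namespace Summit.Ventures.Crystal3D

namespace HullRotSys

open Literature.Geometry.DiscreteGeometry Finset

variable {X : Finset (EuclideanSpace ℝ (Fin 3))}

/-! ## Iterates of `σ_H` and the return of every dart -/

/-- Iterates of `σ_H` map darts to darts. -/
theorem iterate_hullSucc_mem_hullDarts (hX1 : ∀ y ∈ X, ‖y‖ = 1)
    (h0 : (0 : EuclideanSpace ℝ (Fin 3)) ∈ interior (convexHull ℝ (X : Set _))) {p
        : EuclideanSpace ℝ (Fin 3) × EuclideanSpace ℝ (Fin 3)} (hp : p ∈ hullDarts X)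
    (k : ℕ) : (hullSucc X)^[k] p ∈ hullDarts X := by
  induction k with
  | zero => exact hp
  | succ k ih => rw [Function.iterate_succ_apply']; exact hullSucc_mem_hullDarts hX1 h0 ih

/-- Iterates of `σ_H` are injective on the darts. -/
theorem injOn_iterate_hullSucc (hX1 : ∀ y ∈ X, ‖y‖ = 1)
    (h0 : (0 : EuclideanSpace ℝ (Fin 3)) ∈ interior (convexHull ℝ (X : Set _))) (k : ℕ) :
    Set.InjOn ((hullSucc X)^[k]) (hullDarts X : Set _) := by
  induction k with
  | zero => exact Set.injOn_id _
  | succ k ih =>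
    rw [Function.iterate_succ]
    exact ih.comp (hullSucc_injOn hX1 h0) fun p hp =>
      Finset.mem_coe.2 (hullSucc_mem_hullDarts hX1 h0 (Finset.mem_coe.1 hp))

/-- **Every dart returns**: `σ_H^k d = d` for some `k ≥ 1` (pigeonhole + injectivity). -/
theorem exists_iterate_hullSucc_eq_self (hX1 : ∀ y ∈ X, ‖y‖ = 1)
    (h0 : (0 : EuclideanSpace ℝ (Fin 3)) ∈ interior (convexHull ℝ (X : Set _))) {p
        : EuclideanSpace ℝ (Fin 3) × EuclideanSpace ℝ (Fin 3)} (hp : p ∈ hullDarts X) :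
    ∃ k : ℕ, 0 < k ∧ (hullSucc X)^[k] p = p := by
  have hlt : (hullDarts X).card < (range ((hullDarts X).card + 1)).card := by
    rw [card_range]; exact Nat.lt_succ_self _
  obtain ⟨i, -, j, -, hij, heq⟩ := exists_ne_map_eq_of_card_lt_of_maps_to hlt
    (f := fun k => (hullSucc X)^[k] p) fun k _ => iterate_hullSucc_mem_hullDarts hX1 h0 hp k
  have heq' : (hullSucc X)^[i] p = (hullSucc X)^[j] p := heq
  -- from `σ^i p = σ^j p` with `i ≠ j` cancel the smaller exponent
  wlog hlt' : i < j generalizing i j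
  · exact this j i hij.symm heq.symm heq'.symm (lt_of_le_of_ne (not_lt.1 hlt') hij.symm)
  refine ⟨j - i, Nat.sub_pos_of_lt hlt', ?_⟩
  have hsplit : (hullSucc X)^[j] p = (hullSucc X)^[i] ((hullSucc X)^[j - i] p) := by
    rw [← Function.iterate_add_apply, Nat.add_sub_cancel' hlt'.le]
  rw [hsplit] at heq'
  exact (injOn_iterate_hullSucc hX1 h0 i (Finset.mem_coe.2
      (iterate_hullSucc_mem_hullDarts hX1 h0 hp _))
    (Finset.mem_coe.2 hp) heq'.symm)

/-! ## The rotation at a vertex is a single cycle -/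

/-- One step: if `σ_H^k (y, a) = (y, c)` then `σ_H^(k+1) (y, a) = (y, succV X y c)`. -/
theorem iterate_hullSucc_succ_of_eq {y a c : EuclideanSpace ℝ (Fin 3)} {k : ℕ} (h :
    (hullSucc X)^[k] (y, a) = (y, c)) :
    (hullSucc X)^[k + 1] (y, a) = (y, succV X y c) := by
  rw [Function.iterate_succ_apply', h, hullSucc_mk]

/-- One step back: a `σ_H`-predecessor of a point on the orbit of `(y, a)` is on the orbit. -/
theorem exists_iterate_eq_of_hullSucc_eq (hX1 : ∀ y ∈ X, ‖y‖ = 1)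
    (h0 : (0 : EuclideanSpace ℝ (Fin 3)) ∈ interior (convexHull ℝ (X : Set _))) {y a c c'
        : EuclideanSpace ℝ (Fin 3)}
    (ha : (y, a) ∈ hullDarts X) (hc' : (y, c') ∈ hullDarts X) (hsucc : hullSucc X (y, c') = (y, c))
    {k : ℕ} (h : (hullSucc X)^[k] (y, a) = (y, c)) : ∃ m : ℕ, (hullSucc X)^[m] (y, a) = (y, c')
        := by
  obtain ⟨P, hP, hper⟩ := exists_iterate_hullSucc_eq_self hX1 h0 ha
  refine ⟨k + (P - 1), ?_⟩
  have hm : (hullSucc X)^[k + (P - 1) + 1] (y, a) = (y, c) := by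
    rw [show k + (P - 1) + 1 = k + P by omega, Function.iterate_add_apply, hper, h]
  rw [Function.iterate_succ_apply'] at hm
  rw [← hsucc] at hm
  exact hullSucc_injOn hX1 h0 (Finset.mem_coe.2 (iterate_hullSucc_mem_hullDarts hX1 h0 ha _))
    (Finset.mem_coe.2 hc') hm

/-- **The fan triangles at `y` sharing a side through `y` with `{y, c, σ c}`** (where
`σ c = succV X y c`): such a triangle is `{y, c, σ c}` itself, or `{y, σ c, σ (σ c)}`, or
`{y, e, c}` with `σ e = c` — one step forward or backward in the rotation at `y`. -/
theorem tri_sharing_side_cases (hX1 : ∀ y ∈ X, ‖y‖ = 1)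
    (h0 : (0 : EuclideanSpace ℝ (Fin 3)) ∈ interior (convexHull ℝ (X : Set _))) {y c d
        : EuclideanSpace ℝ (Fin 3)} (hcd : (y, c) ∈ hullDarts X)
    (hd : succV X y c = d) {t' : Finset (EuclideanSpace ℝ (Fin 3))} (ht' : t' ∈ fanTriSets X)
        (hyt' : y ∈ t')
    (hcard : (({y, c, d} : Finset (EuclideanSpace ℝ (Fin 3))) ∩ t').card = 2) :
    t' = {y, c, d} ∨ t' = {y, d, succV X y d} ∨
      ∃ e : EuclideanSpace ℝ (Fin 3), (y, e) ∈ hullDarts X ∧ succV X y e = c ∧ t' = {y, e, c} := by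
  have hpt : IsPosThird X y c d := hd ▸ isPosThird_succV hX1 h0 hcd
  have hdd : (y, d) ∈ hullDarts X := mk_mem_hullDarts hpt.1 (by simp) (by simp) hpt.ne₁₃
  -- a second common vertex `z ≠ y`, and the third vertex `e` of `t'`
  have h1 : 1 < (({y, c, d} : Finset (EuclideanSpace ℝ (Fin 3))) ∩ t').card
      := by rw [hcard]; exact Nat.lt_succ_self 1
  obtain ⟨z, hz, hzy⟩ := exists_mem_ne h1 y
  rw [mem_inter] at hz
  obtain ⟨e, hte, hye, hze⟩ := exists_eq_triple hX1 ht' hyt' hz.2 (Ne.symm hzy)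
  subst hte
  have hO' := orient3_ne_zero_of_mem_fanTriSets hX1 ht' (Ne.symm hzy) hye hze
  have hed : (y, e) ∈ hullDarts X := mk_mem_hullDarts ht' (by simp) (by simp) hye
  have hz1 := hz.1
  simp only [mem_insert, mem_singleton] at hz1
  rcases hz1 with hzy' | hzc | hzd
  · exact absurd hzy' hzy
  · -- shared side `{y, c}`
    subst hzc
    rcases lt_or_gt_of_ne hO' with hneg | hpos
    · -- `e` is the predecessor of `c`
      right; right
      refine ⟨e, hed, (succV_eq_iff hX1 h0 hed).2 ⟨?_, ?_⟩, ?_⟩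
      · have ee : ({y, e, z} : Finset (EuclideanSpace ℝ (Fin 3))) = {y, z, e} := by
          rw [pair_comm]
        rw [ee]; exact ht'
      · rw [orient3_swap_right]; linarith
      · rw [pair_comm]
    · -- `e` is the successor `d`
      left
      rw [← hd, (succV_eq_iff hX1 h0 hcd).2 ⟨ht', hpos⟩]
  · -- shared side `{y, d}`
    subst hzd
    rcases lt_or_gt_of_ne hO' with hneg | hpos
    · -- `e` is the predecessor of `d`, i.e. `e = c`
      left
      have hpe : IsPosThird X y e z := by
        refine ⟨?_, by rw [orient3_swap_right]; linarith⟩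
        have ee : ({y, e, z} : Finset (EuclideanSpace ℝ (Fin 3))) = {y, z, e} := by
          rw [pair_comm]
        rw [ee]; exact ht'
      have h1' : hullSucc X (y, e) = (y, z) := (hullSucc_eq_iff hX1 h0 hed).2 hpe
      have h2' : hullSucc X (y, c) = (y, z) := (hullSucc_eq_iff hX1 h0 hcd).2 hpt
      have hec : e = c := congrArg Prod.snd
        (hullSucc_injOn hX1 h0 (Finset.mem_coe.2 hed) (Finset.mem_coe.2 hcd) (h1'.trans h2'.symm))
      rw [hec]
      rw [pair_comm]
    · -- `e` is the successor of `d`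
      right; left
      rw [(succV_eq_iff hX1 h0 hdd).2 ⟨ht', hpos⟩]

/-- **The vertex rotation is a single cycle**: `σ_H` acts transitively on the darts with tail
`y` — for darts `(y, a)`, `(y, b)` some iterate carries one to the other. Proof: the triangles
`{y, c, succV X y c}` over the orbit of `(y, a)` form a nonempty family of fan triangles at `y`
closed under sharing a side through `y` (`tri_sharing_side_cases`: one step forward or backward
along the orbit); by the Literature's `fanTriSets_link` it is ALL of them, in particular it
contains `{y, b, succV X y b}`. -/
theorem exists_iterate_hullSucc_eq (hX1 : ∀ y ∈ X, ‖y‖ = 1)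
    (h0 : (0 : EuclideanSpace ℝ (Fin 3)) ∈ interior (convexHull ℝ (X : Set _))) {y a b
        : EuclideanSpace ℝ (Fin 3)} (ha : (y, a) ∈ hullDarts X)
    (hb : (y, b) ∈ hullDarts X) : ∃ k : ℕ, (hullSucc X)^[k] (y, a) = (y, b) := by
  classical
  have hOdart : ∀ {c : EuclideanSpace ℝ (Fin 3)} {k : ℕ}, (hullSucc X)^[k] (y, a) = (y, c) →
      (y, c) ∈ hullDarts X := by
    intro c k hk; rw [← hk]; exact iterate_hullSucc_mem_hullDarts hX1 h0 ha k
  -- the family of triangles `{y, c, succV X y c}` over the heads `c` of the orbit of `(y, a)`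
  obtain ⟨A, hA⟩ : ∃ A : Finset (Finset (EuclideanSpace ℝ (Fin 3))), A =
      ((fanTriSets X).filter fun t => y ∈ t).filter
      (fun t => ∃ c : EuclideanSpace ℝ (Fin 3), (∃ k : ℕ, (hullSucc X)^[k] (y, a) = (y, c)) ∧ t =
          {y, c, succV X y c}) :=
    ⟨_, rfl⟩
  have hAsub : A ⊆ (fanTriSets X).filter fun t => y ∈ t := by rw [hA]; exact filter_subset _ _
  have hmemA : ∀ {c : EuclideanSpace ℝ (Fin 3)} {k : ℕ}, (hullSucc X)^[k] (y, a) = (y, c) →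
      ({y, c, succV X y c} : Finset (EuclideanSpace ℝ (Fin 3))) ∈ A := by
    intro c k hk
    have hpt := isPosThird_succV hX1 h0 (hOdart hk)
    rw [hA]
    exact mem_filter.2 ⟨mem_filter.2 ⟨hpt.1, by simp⟩, c, ⟨k, hk⟩, rfl⟩
  have hAmem : ∀ {t : Finset (EuclideanSpace ℝ (Fin 3))}, t ∈ A →
      ∃ (c : EuclideanSpace ℝ (Fin 3)) (k : ℕ), (hullSucc X)^[k] (y, a) = (y, c) ∧ t =
          {y, c, succV X y c} := by
    intro t ht
    rw [hA] at ht
    obtain ⟨c, ⟨k, hk⟩, rfl⟩ := (mem_filter.1 ht).2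
    exact ⟨c, k, hk, rfl⟩
  have hne : A.Nonempty := ⟨_, hmemA (k := 0) rfl⟩
  -- closure under sharing a side through `y`: one step forward or backward along the orbit
  have hcl : ∀ t ∈ A, ∀ t' ∈ fanTriSets X, y ∈ t' → (t ∩ t').card = 2 → t' ∈ A := by
    intro t ht t' ht' hyt' hcard
    obtain ⟨c, k, hk, rfl⟩ := hAmem ht
    rcases tri_sharing_side_cases hX1 h0
        (hOdart hk) rfl ht' hyt' hcard with h1 | h2 | ⟨e, hed, hse, h3⟩
    · rw [h1]; exact hmemA hk
    · rw [h2]; exact hmemA (iterate_hullSucc_succ_of_eq hk)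
    · obtain ⟨m, hm⟩ :=
        exists_iterate_eq_of_hullSucc_eq hX1 h0 ha hed (by rw [hullSucc_mk, hse]) hk
      have hA' := hmemA hm
      rw [hse] at hA'
      rw [h3]; exact hA'
  -- the family is everything at `y`; read off `b`
  have hall := fanTriSets_link hX1 h0 hAsub hne hcl
  have hbt : ({y, b, succV X y b} : Finset (EuclideanSpace ℝ (Fin 3))) ∈ A := by
    rw [hall]
    exact mem_filter.2 ⟨(isPosThird_succV hX1 h0 hb).1, by simp⟩
  obtain ⟨c, k, hk, heq⟩ := hAmem hbt
  have hyb : y ≠ b := fst_ne_snd_of_mem_hullDarts hb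
  have hbmem : b ∈ ({y, c, succV X y c} : Finset (EuclideanSpace ℝ (Fin 3))) := by rw [← heq]; simp
  simp only [mem_insert, mem_singleton] at hbmem
  rcases hbmem with hby | hbc | hbd
  · exact absurd hby.symm hyb
  · exact ⟨k, by rw [hk, hbc]⟩
  · exact ⟨k + 1, by rw [iterate_hullSucc_succ_of_eq hk, hbd]⟩

/-- Corollary: the darts with tail `y` form ONE `σ_H`-orbit — two darts lie on the same
`σ_H`-orbit iff they have the same tail. -/
theorem exists_iterate_hullSucc_eq_iff (hX1 : ∀ y ∈ X, ‖y‖ = 1)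
    (h0 : (0 : EuclideanSpace ℝ (Fin 3)) ∈ interior (convexHull ℝ (X : Set _))) {p q
        : EuclideanSpace ℝ (Fin 3) × EuclideanSpace ℝ (Fin 3)} (hp : p ∈ hullDarts X)
    (hq : q ∈ hullDarts X) : (∃ k : ℕ, (hullSucc X)^[k] p = q) ↔ p.1 = q.1 := by
  constructor
  · rintro ⟨k, rfl⟩; exact (iterate_hullSucc_fst k p).symm
  · intro h
    obtain ⟨y, a⟩ := p
    obtain ⟨y', b⟩ := q
    simp only at h
    subst h
    exact exists_iterate_hullSucc_eq hX1 h0 hp hq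

/-! ## Connectedness -/

/-- A set of darts closed under `σ_H` is closed under its iterates. -/
theorem iterate_mem_of_closed {S : Finset (EuclideanSpace ℝ (Fin 3) × EuclideanSpace ℝ (Fin 3))}
    (hsucc : ∀ p ∈ S, hullSucc X p ∈ S)
    {p : EuclideanSpace ℝ (Fin 3) × EuclideanSpace ℝ (Fin 3)} (hp : p ∈ S) (k : ℕ) :
        (hullSucc X)^[k] p ∈ S := by
  induction k with
  | zero => exact hp
  | succ k ih => rw [Function.iterate_succ_apply']; exact hsucc _ ih

/-- **The hull rotation system is connected** (closure form): a nonempty set of darts closed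
under the vertex rotation `σ_H` and the edge involution `α` is the whole dart set. (The set of
tails of `S` is closed under fan-triangle adjacency, hence all of `X` by the Literature's
`eq_of_fanTriSets_closed`; and with a tail, `S` contains the whole vertex cycle.) -/
theorem eq_hullDarts_of_closed (hX1 : ∀ y ∈ X, ‖y‖ = 1)
    (h0 : (0 : EuclideanSpace ℝ (Fin 3)) ∈ interior (convexHull ℝ (X : Set _))) {S : Finset
        (EuclideanSpace ℝ (Fin 3) × EuclideanSpace ℝ (Fin 3))}
    (hS : S ⊆ hullDarts X) (hne : S.Nonempty) (hsucc : ∀ p ∈ S, hullSucc X p ∈ S)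
    (hswap : ∀ p ∈ S, p.swap ∈ S) : S = hullDarts X := by
  classical
  -- with one dart at `y`, all darts at `y`
  have hstar : ∀ {y a b : EuclideanSpace ℝ (Fin 3)}, (y, a) ∈ S → (y, b) ∈ hullDarts X → (y, b)
      ∈ S := by
    intro y a b ha hb
    obtain ⟨k, hk⟩ := exists_iterate_hullSucc_eq hX1 h0 (hS ha) hb
    rw [← hk]; exact iterate_mem_of_closed hsucc ha k
  -- the tails of `S` are all of `X`
  set D : Finset (EuclideanSpace ℝ (Fin 3)) := S.image Prod.fst with hD
  have hDX : D ⊆ X := by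
    intro y hy
    obtain ⟨p, hp, rfl⟩ := mem_image.1 hy
    exact fst_mem_of_mem_hullDarts hX1 (hS hp)
  have hDne : D.Nonempty := hne.image _
  have hcl : ∀ t ∈ fanTriSets X, ∀ y ∈ t, y ∈ D → t ⊆ D := by
    intro t ht y hyt hyD z hzt
    by_cases hzy : z = y
    · rw [hzy]; exact hyD
    · obtain ⟨p, hp, hpy⟩ := mem_image.1 hyD
      obtain ⟨y', a⟩ := p
      simp only at hpy
      subst hpy
      have hz : (y', z) ∈ S := hstar hp (mk_mem_hullDarts ht hyt hzt (Ne.symm hzy))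
      exact mem_image.2 ⟨(z, y'), hswap _ hz, rfl⟩
  have hDall : D = X := eq_of_fanTriSets_closed hX1 h0 hDX hDne hcl
  -- conclude
  refine Subset.antisymm hS fun q hq => ?_
  obtain ⟨y, b⟩ := q
  have hy : y ∈ D := by rw [hDall]; exact fst_mem_of_mem_hullDarts hX1 hq
  obtain ⟨p, hp, hpy⟩ := mem_image.1 hy
  obtain ⟨y', a⟩ := p
  simp only at hpy
  subst hpy
  exact hstar hp hq

end HullRotSys

end Summit.Ventures.Crystal3D
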